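import Summits.QuantumFields.QCD.Theses.PauliWegnerSea
import Summits.QuantumFields.QCD.Theorems.PauliWegnerSeaGluonicCompletionSu3CircleWord
import Summits.QuantumFields.QCD.Theorems.TiltedFlatness.Negative.TwoWellFloor
import Summits.QuantumFields.QCD.Theorems.PauliWegnerSeaSingleLinkLogFlatnessCore
import Summits.QuantumFields.QCD.Theorems.PauliWegnerSeaSingleLinkLogFlatnessDet
import Literature.MathematicalPhysics.QuantumFieldTheory.StrongCouplingActivities

/-!
# Route `PauliWegnerSea`, item `SingleLinkLogFlatness` (stmt-QuantumFields-11516) — proof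

`theorem singleLinkLogFlatness_proof : SingleLinkLogFlatness`, with the explicit constant
`c = 9 · 48 · log 2 = 432 log 2`: for every volume `L`, background `U`, bare mass `m₀`, edge `e` and
`g₀ ∈ SU(3)`,

  `‖det D_W(U[e ↦ g₀]; m₀, 1)‖ · e^{-c} ≤ exp ∫ log ‖det D_W(U[e ↦ g]; m₀, 1)‖ dHaar(g)`.

## The argument

Write `F(g) = det D_W(U[e ↦ g])`.  No Haar density, Weyl formula or Łojasiewicz inequality is used;
the compact group inherits the ONE-VARIABLE Mahler inequality through a surjective circle word:

1. (file `…Det`) along every curve `θ ↦ g c(θ) h` with `c` one of the four circle letters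
   `P₁₂, R₁₂, P₀₁, R₀₁` of `SU(3)`, `‖F(g c(θ) h)‖ = ‖q(e^{iθ})‖` for a polynomial `q` with
   `deg q ≤ 48`, uniformly in the volume (Leibniz with row degrees: only the `12 + 12` rows at the two
   endpoints of `e` move);
2. (file `…Circle`) one-variable Mahler: `‖q(e^{iθ₀})‖ ≤ 2^{48} M(q)`, in the junk-safe truncated form
   `log (max ‖q(e^{iθ₀})‖ e^{-N}) - 48 log 2 ≤ (2π)⁻¹ ∫ log (max ‖q(e^{iθ})‖ e^{-N}) dθ`;
3. (file `…Core`) letter averages preserve the Haar integral (right invariance and Fubini), so iterating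
   step 2 along the nine-letter word `P₁₂ R₁₂ P₁₂ P₀₁ R₀₁ P₀₁ P₁₂ R₁₂ P₁₂`, which from any `g` reaches
   `g₀` (`stub_su3CircleWord` applied to `g⁻¹ g₀`), gives
   `∫ max (log ‖F‖) (-N) dHaar ≥ log ‖F g₀‖ - 432 log 2` for every `N`, and `N → ∞` by monotone
   convergence (which also yields `log ‖F‖ ∈ L¹(Haar)` whenever `F(g₀) ≠ 0`).

This file supplies the four letters as continuous curves in `SU(3)` with entries of degree `≤ 1`, the
continuity (hence measurability and boundedness) of `F`, and the assembly.
-/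


noncomputable section

namespace Summit.QuantumFields.QCD.Theorems

open scoped BigOperators
open MeasureTheory Complex Polynomial
open Literature.MathematicalPhysics.QuantumFieldTheory Literature.MathematicalPhysics.QuantumLattice
  Literature.Probability.LatticeModels

namespace SingleLinkLogFlatness

/-- The colour group `SU(3)` (local shorthand). -/
local notation "SU3" => Matrix.specialUnitaryGroup (Fin 3) ℂ

/-! ### The four circle letters of `SU(3)` as curves in the group -/

/-- `conj (e^{ix}) e^{ix} = 1`-type identity: `conj (e^{iθ}) = e^{-iθ}`. [folklore] -/
theorem conj_exp_mul_I (θ : ℝ) : (starRingEnd ℂ) (cexp (θ * I)) = cexp (-(θ * I)) := by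
  rw [← Complex.exp_conj, map_mul, Complex.conj_ofReal, Complex.conj_I, mul_neg]

/-- `conj (e^{-iθ}) = e^{iθ}`. [folklore] -/
theorem conj_exp_neg_mul_I (θ : ℝ) : (starRingEnd ℂ) (cexp (-(θ * I))) = cexp (θ * I) := by
  rw [← Complex.exp_conj, map_neg, map_mul, Complex.conj_ofReal, Complex.conj_I, mul_neg, neg_neg]

/-- `e^{iθ} e^{-iθ} = 1`. [folklore] -/
theorem exp_mul_exp_neg (θ : ℝ) : cexp (θ * I) * cexp (-(θ * I)) = 1 := by
  rw [← Complex.exp_add, add_neg_cancel, Complex.exp_zero]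


/-- The letter `P₁₂(θ) = diag(1, e^{iθ}, e^{-iθ})` is special unitary. [folklore] -/
theorem P12_mem (θ : ℝ) :
    !![(1 : ℂ), 0, 0; 0, cexp (θ * I), 0; 0, 0, cexp (-(θ * I))] ∈ SU3 := by
  rw [Matrix.mem_specialUnitaryGroup_iff, Matrix.mem_unitaryGroup_iff']
  constructor
  · ext i j
    fin_cases i <;> fin_cases j <;>
      simp [Matrix.mul_apply, Fin.sum_univ_three, conj_exp_mul_I, conj_exp_neg_mul_I, exp_mul_exp_neg]
    rw [mul_comm]; exact exp_mul_exp_neg θ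
  · rw [Matrix.det_fin_three]
    simp [exp_mul_exp_neg]

/-- The letter `R₁₂(θ)` (real rotation of the coordinates `1, 2`) is special unitary. [folklore] -/
theorem R12_mem (θ : ℝ) :
    !![(1 : ℂ), 0, 0; 0, (Real.cos θ : ℂ), -(Real.sin θ : ℂ); 0, (Real.sin θ : ℂ), (Real.cos θ : ℂ)] ∈ SU3 := by
  have hc : Complex.cos θ ^ 2 + Complex.sin θ ^ 2 = 1 := Complex.cos_sq_add_sin_sq _
  rw [Matrix.mem_specialUnitaryGroup_iff, Matrix.mem_unitaryGroup_iff']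
  constructor
  · ext i j
    fin_cases i <;> fin_cases j <;>
      simp [Matrix.mul_apply, Fin.sum_univ_three, ← Complex.cos_conj, ← Complex.sin_conj,
        Complex.conj_ofReal]
    all_goals first | linear_combination hc | ring
  · rw [Matrix.det_fin_three]
    simp
    linear_combination hc

/-- The letter `P₀₁(θ) = diag(e^{iθ}, e^{-iθ}, 1)` is special unitary. [folklore] -/
theorem P01_mem (θ : ℝ) :
    !![cexp (θ * I), 0, 0; 0, cexp (-(θ * I)), 0; 0, 0, (1 : ℂ)] ∈ SU3 := by
  rw [Matrix.mem_specialUnitaryGroup_iff, Matrix.mem_unitaryGroup_iff']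
  constructor
  · ext i j
    fin_cases i <;> fin_cases j <;>
      simp [Matrix.mul_apply, Fin.sum_univ_three, conj_exp_mul_I, conj_exp_neg_mul_I, exp_mul_exp_neg]
    rw [mul_comm]; exact exp_mul_exp_neg θ
  · rw [Matrix.det_fin_three]
    simp [exp_mul_exp_neg]

/-- The letter `R₀₁(θ)` (real rotation of the coordinates `0, 1`) is special unitary. [folklore] -/
theorem R01_mem (θ : ℝ) :
    !![(Real.cos θ : ℂ), -(Real.sin θ : ℂ), 0; (Real.sin θ : ℂ), (Real.cos θ : ℂ), 0; 0, 0, (1 : ℂ)] ∈ SU3 := by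
  have hc : Complex.cos θ ^ 2 + Complex.sin θ ^ 2 = 1 := Complex.cos_sq_add_sin_sq _
  rw [Matrix.mem_specialUnitaryGroup_iff, Matrix.mem_unitaryGroup_iff']
  constructor
  · ext i j
    fin_cases i <;> fin_cases j <;>
      simp [Matrix.mul_apply, Fin.sum_univ_three, ← Complex.cos_conj, ← Complex.sin_conj,
        Complex.conj_ofReal]
    all_goals first | linear_combination hc | ring
  · rw [Matrix.det_fin_three]
    simp
    linear_combination hc

/-! ### Entries of the letters are trigonometric polynomials of degree `≤ 1` -/

/-- Constants: `c = (c X)(e^{iθ}) e^{-iθ}`. [folklore] -/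
theorem tp1_const (c : ℂ) : ∃ p : ℂ[X], p.natDegree ≤ 2 * 1 ∧ ∀ θ : ℝ,
    c = p.eval (cexp (θ * I)) * cexp (-((1 : ℕ) * θ * I)) :=
  tp_const 1 c

/-- `e^{iθ} = X²(e^{iθ}) e^{-iθ}`. [folklore] -/
theorem tp1_exp : ∃ p : ℂ[X], p.natDegree ≤ 2 * 1 ∧ ∀ θ : ℝ,
    cexp (θ * I) = p.eval (cexp (θ * I)) * cexp (-((1 : ℕ) * θ * I)) := by
  refine ⟨X ^ 2, by simp, fun θ => ?_⟩
  rw [eval_pow, eval_X, Nat.cast_one, one_mul, sq, mul_assoc, exp_mul_exp_neg, mul_one]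

/-- `e^{-iθ} = 1(e^{iθ}) e^{-iθ}`. [folklore] -/
theorem tp1_exp_neg : ∃ p : ℂ[X], p.natDegree ≤ 2 * 1 ∧ ∀ θ : ℝ,
    cexp (-(θ * I)) = p.eval (cexp (θ * I)) * cexp (-((1 : ℕ) * θ * I)) :=
  ⟨1, by simp, fun θ => by rw [eval_one, Nat.cast_one, one_mul, one_mul]⟩

/-- `cos θ = ((X² + 1)/2)(e^{iθ}) e^{-iθ}`. [folklore] -/
theorem tp1_cos : ∃ p : ℂ[X], p.natDegree ≤ 2 * 1 ∧ ∀ θ : ℝ,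
    (Real.cos θ : ℂ) = p.eval (cexp (θ * I)) * cexp (-((1 : ℕ) * θ * I)) := by
  refine ⟨C (1 / 2) * (X ^ 2 + 1), ?_, fun θ => ?_⟩
  · refine (natDegree_C_mul_le _ _).trans ?_
    refine (natDegree_add_le _ _).trans ?_
    simp
  · rw [Complex.ofReal_cos, eval_mul, eval_C, eval_add, eval_pow, eval_X, eval_one, Nat.cast_one, one_mul]
    have h2 := Complex.two_cos (θ : ℂ)
    have hsq : cexp (θ * I) ^ 2 * cexp (-(θ * I)) = cexp (θ * I) := by
      rw [sq, mul_assoc, exp_mul_exp_neg, mul_one]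
    rw [neg_mul] at h2
    linear_combination (1 / 2 : ℂ) * h2 - (1 / 2 : ℂ) * hsq

/-- `sin θ = ((1 - X²) i/2)(e^{iθ}) e^{-iθ}`. [folklore] -/
theorem tp1_sin : ∃ p : ℂ[X], p.natDegree ≤ 2 * 1 ∧ ∀ θ : ℝ,
    (Real.sin θ : ℂ) = p.eval (cexp (θ * I)) * cexp (-((1 : ℕ) * θ * I)) := by
  refine ⟨C (I / 2) * (1 - X ^ 2), ?_, fun θ => ?_⟩
  · refine (natDegree_C_mul_le _ _).trans ?_
    refine (natDegree_sub_le _ _).trans ?_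
    simp
  · rw [Complex.ofReal_sin, eval_mul, eval_C, eval_sub, eval_pow, eval_X, eval_one, Nat.cast_one,
      one_mul]
    have h2 := Complex.two_sin (θ : ℂ)
    have hsq : cexp (θ * I) ^ 2 * cexp (-(θ * I)) = cexp (θ * I) := by
      rw [sq, mul_assoc, exp_mul_exp_neg, mul_one]
    rw [neg_mul] at h2
    linear_combination (1 / 2 : ℂ) * h2 + (I / 2 : ℂ) * hsq

/-- `-sin θ = ((X² - 1) i/2)(e^{iθ}) e^{-iθ}`. [folklore] -/
theorem tp1_neg_sin : ∃ p : ℂ[X], p.natDegree ≤ 2 * 1 ∧ ∀ θ : ℝ,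
    -(Real.sin θ : ℂ) = p.eval (cexp (θ * I)) * cexp (-((1 : ℕ) * θ * I)) := by
  obtain ⟨p, hp, h⟩ := tp_const_mul (-1) tp1_sin
  exact ⟨p, hp, fun θ => by rw [← neg_one_mul]; exact h θ⟩

/-- Entries of `P₁₂(θ)` lie in `T(1)`. [folklore] -/
theorem tp1_P12 (a b : Fin 3) : ∃ p : ℂ[X], p.natDegree ≤ 2 * 1 ∧ ∀ θ : ℝ,
    (!![(1 : ℂ), 0, 0; 0, cexp (θ * I), 0; 0, 0, cexp (-(θ * I))] : Matrix (Fin 3) (Fin 3) ℂ) a b =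
      p.eval (cexp (θ * I)) * cexp (-((1 : ℕ) * θ * I)) := by
  fin_cases a <;> fin_cases b <;>
    first | exact tp1_const _ | exact tp1_exp | exact tp1_exp_neg

/-- Entries of `R₁₂(θ)` lie in `T(1)`. [folklore] -/
theorem tp1_R12 (a b : Fin 3) : ∃ p : ℂ[X], p.natDegree ≤ 2 * 1 ∧ ∀ θ : ℝ,
    (!![(1 : ℂ), 0, 0; 0, (Real.cos θ : ℂ), -(Real.sin θ : ℂ); 0, (Real.sin θ : ℂ), (Real.cos θ : ℂ)] :
      Matrix (Fin 3) (Fin 3) ℂ) a b = p.eval (cexp (θ * I)) * cexp (-((1 : ℕ) * θ * I)) := by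
  fin_cases a <;> fin_cases b <;>
    first | exact tp1_const _ | exact tp1_cos | exact tp1_sin | exact tp1_neg_sin

/-- Entries of `P₀₁(θ)` lie in `T(1)`. [folklore] -/
theorem tp1_P01 (a b : Fin 3) : ∃ p : ℂ[X], p.natDegree ≤ 2 * 1 ∧ ∀ θ : ℝ,
    (!![cexp (θ * I), 0, 0; 0, cexp (-(θ * I)), 0; 0, 0, (1 : ℂ)] : Matrix (Fin 3) (Fin 3) ℂ) a b =
      p.eval (cexp (θ * I)) * cexp (-((1 : ℕ) * θ * I)) := by
  fin_cases a <;> fin_cases b <;>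
    first | exact tp1_const _ | exact tp1_exp | exact tp1_exp_neg

/-- Entries of `R₀₁(θ)` lie in `T(1)`. [folklore] -/
theorem tp1_R01 (a b : Fin 3) : ∃ p : ℂ[X], p.natDegree ≤ 2 * 1 ∧ ∀ θ : ℝ,
    (!![(Real.cos θ : ℂ), -(Real.sin θ : ℂ), 0; (Real.sin θ : ℂ), (Real.cos θ : ℂ), 0; 0, 0, (1 : ℂ)] :
      Matrix (Fin 3) (Fin 3) ℂ) a b = p.eval (cexp (θ * I)) * cexp (-((1 : ℕ) * θ * I)) := by
  fin_cases a <;> fin_cases b <;>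
    first | exact tp1_const _ | exact tp1_cos | exact tp1_sin | exact tp1_neg_sin

/-! ### Letters as curves in `SU(3)`: continuity and the degree bound `48` -/

/-- A curve of special unitary matrices with continuous entries is a continuous curve in `SU(3)`.
[folklore] -/
theorem continuous_letter (M : ℝ → Matrix (Fin 3) (Fin 3) ℂ) (hmem : ∀ θ, M θ ∈ SU3)
    (hM : Continuous M) : Continuous fun θ => (⟨M θ, hmem θ⟩ : SU3) :=
  hM.subtype_mk _

/-- The Wilson determinant is continuous in the moving link. [folklore] -/
theorem continuous_det_wilsonDirac_update {L : ℕ} [NeZero L] (U : GaugeConfig 4 L SU3) (m₀ : ℝ)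
    (e : Edge 4 L) :
    Continuous fun g : SU3 => (wilsonDirac (fundamentalRep (Fin 3)) (Function.update U e g) m₀ 1).det := by
  refine Continuous.matrix_det (continuous_matrix fun p q => ?_)
  exact (TiltedFlatnessNegative.continuous_wilsonDirac_apply (fundamentalRep (Fin 3))
    (continuous_fundamentalRep (Fin 3)) m₀ 1 p q).comp (continuous_const.update e continuous_id)

/-- The letter `P₁₂` is a continuous curve in `SU(3)`. [folklore] -/
theorem continuous_cP12 : Continuous fun θ : ℝ => (⟨_, P12_mem θ⟩ : SU3) :=
  continuous_letter _ P12_mem (continuous_matrix fun i j => by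
    fin_cases i <;> fin_cases j <;> simp <;> fun_prop)

/-- The letter `R₁₂` is a continuous curve in `SU(3)`. [folklore] -/
theorem continuous_cR12 : Continuous fun θ : ℝ => (⟨_, R12_mem θ⟩ : SU3) :=
  continuous_letter _ R12_mem (continuous_matrix fun i j => by
    fin_cases i <;> fin_cases j <;> simp <;> fun_prop)

/-- The letter `P₀₁` is a continuous curve in `SU(3)`. [folklore] -/
theorem continuous_cP01 : Continuous fun θ : ℝ => (⟨_, P01_mem θ⟩ : SU3) :=
  continuous_letter _ P01_mem (continuous_matrix fun i j => by
    fin_cases i <;> fin_cases j <;> simp <;> fun_prop)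

/-- The letter `R₀₁` is a continuous curve in `SU(3)`. [folklore] -/
theorem continuous_cR01 : Continuous fun θ : ℝ => (⟨_, R01_mem θ⟩ : SU3) :=
  continuous_letter _ R01_mem (continuous_matrix fun i j => by
    fin_cases i <;> fin_cases j <;> simp <;> fun_prop)

/-- Degree bound `48` along the translated letter `P₁₂`. [folklore] -/
theorem hq_cP12 {L : ℕ} [NeZero L] (U : GaugeConfig 4 L SU3) (m₀ : ℝ) (e : Edge 4 L) (g h : SU3) :
    ∃ q : ℂ[X], q.natDegree ≤ 48 ∧ ∀ θ : ℝ,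
      ‖(wilsonDirac (fundamentalRep (Fin 3)) (Function.update U e (g * ⟨_, P12_mem θ⟩ * h)) m₀ 1).det‖ =
        ‖q.eval (cexp (θ * I))‖ :=
  exists_poly_norm_det_wilsonDirac_update U m₀ 1 e g h (fun θ => ⟨_, P12_mem θ⟩) _ (fun _ => rfl) tp1_P12

/-- Degree bound `48` along the translated letter `R₁₂`. [folklore] -/
theorem hq_cR12 {L : ℕ} [NeZero L] (U : GaugeConfig 4 L SU3) (m₀ : ℝ) (e : Edge 4 L) (g h : SU3) :
    ∃ q : ℂ[X], q.natDegree ≤ 48 ∧ ∀ θ : ℝ,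
      ‖(wilsonDirac (fundamentalRep (Fin 3)) (Function.update U e (g * ⟨_, R12_mem θ⟩ * h)) m₀ 1).det‖ =
        ‖q.eval (cexp (θ * I))‖ :=
  exists_poly_norm_det_wilsonDirac_update U m₀ 1 e g h (fun θ => ⟨_, R12_mem θ⟩) _ (fun _ => rfl) tp1_R12

/-- Degree bound `48` along the translated letter `P₀₁`. [folklore] -/
theorem hq_cP01 {L : ℕ} [NeZero L] (U : GaugeConfig 4 L SU3) (m₀ : ℝ) (e : Edge 4 L) (g h : SU3) :
    ∃ q : ℂ[X], q.natDegree ≤ 48 ∧ ∀ θ : ℝ,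
      ‖(wilsonDirac (fundamentalRep (Fin 3)) (Function.update U e (g * ⟨_, P01_mem θ⟩ * h)) m₀ 1).det‖ =
        ‖q.eval (cexp (θ * I))‖ :=
  exists_poly_norm_det_wilsonDirac_update U m₀ 1 e g h (fun θ => ⟨_, P01_mem θ⟩) _ (fun _ => rfl) tp1_P01

/-- Degree bound `48` along the translated letter `R₀₁`. [folklore] -/
theorem hq_cR01 {L : ℕ} [NeZero L] (U : GaugeConfig 4 L SU3) (m₀ : ℝ) (e : Edge 4 L) (g h : SU3) :
    ∃ q : ℂ[X], q.natDegree ≤ 48 ∧ ∀ θ : ℝ,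
      ‖(wilsonDirac (fundamentalRep (Fin 3)) (Function.update U e (g * ⟨_, R01_mem θ⟩ * h)) m₀ 1).det‖ =
        ‖q.eval (cexp (θ * I))‖ :=
  exists_poly_norm_det_wilsonDirac_update U m₀ 1 e g h (fun θ => ⟨_, R01_mem θ⟩) _ (fun _ => rfl) tp1_R01

/-- **Every word from any `g` reaches `g₀`** (the nine-letter circle word of `g⁻¹ g₀`,
`stub_su3CircleWord`). [folklore] -/
theorem reach (g g₀ : SU3) : ∃ θs : List ℝ, θs.length =
    [fun θ : ℝ => (⟨_, P12_mem θ⟩ : SU3), fun θ => ⟨_, R12_mem θ⟩, fun θ => ⟨_, P12_mem θ⟩,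
      fun θ => ⟨_, P01_mem θ⟩, fun θ => ⟨_, R01_mem θ⟩, fun θ => ⟨_, P01_mem θ⟩,
      fun θ => ⟨_, P12_mem θ⟩, fun θ => ⟨_, R12_mem θ⟩, fun θ => ⟨_, P12_mem θ⟩].length ∧
    g * (List.zipWith (fun c θ => c θ)
      [fun θ : ℝ => (⟨_, P12_mem θ⟩ : SU3), fun θ => ⟨_, R12_mem θ⟩, fun θ => ⟨_, P12_mem θ⟩,
        fun θ => ⟨_, P01_mem θ⟩, fun θ => ⟨_, R01_mem θ⟩, fun θ => ⟨_, P01_mem θ⟩,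
        fun θ => ⟨_, P12_mem θ⟩, fun θ => ⟨_, R12_mem θ⟩, fun θ => ⟨_, P12_mem θ⟩] θs).prod = g₀ := by
  obtain ⟨θ, hθ⟩ := FiniteSignBudgetAtTheSchemeVolume.stub_su3CircleWord
    ((g⁻¹ * g₀ : SU3) : Matrix (Fin 3) (Fin 3) ℂ) (g⁻¹ * g₀).2
  refine ⟨[θ 0, θ 1, θ 2, θ 3, θ 4, θ 5, θ 6, θ 7, θ 8], rfl, ?_⟩
  rw [← mul_inv_cancel_left g g₀]
  congr 1
  apply Subtype.ext
  rw [hθ]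
  simp only [List.zipWith_cons_cons, List.zipWith_nil_right, List.prod_cons, List.prod_nil, mul_one,
    Submonoid.coe_mul, mul_assoc]

end SingleLinkLogFlatness

open SingleLinkLogFlatness in
/-- **Item `SingleLinkLogFlatness` (stmt-QuantumFields-11516) of route `PauliWegnerSea`.**  With
`c = 9 · 48 · log 2`: for every volume, background `U`, bare mass `m₀`, edge `e` and `g₀ ∈ SU(3)`,
`‖det D_W(U[e ↦ g₀]; m₀, 1)‖ e^{-c} ≤ exp ∫ log ‖det D_W(U[e ↦ g]; m₀, 1)‖ dHaar(g)`.
Proof: the abstract circle-word Mahler inequality `norm_mul_exp_neg_le_exp_integral_log` for the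
right-invariant Haar probability measure of `SU(3)`, the nine circle letters
`P₁₂ R₁₂ P₁₂ P₀₁ R₀₁ P₀₁ P₁₂ R₁₂ P₁₂` (whose words from any `g` reach `g₀`: `reach`, i.e.
`stub_su3CircleWord` applied to `g⁻¹ g₀`) and the degree bound `48` along every translated letter
(`hq_cP12`, …, from `exists_poly_norm_det_wilsonDirac_update`); the determinant is continuous in the link, hence measurable
and bounded on the compact group. -/
theorem singleLinkLogFlatness_proof :
    Summit.QuantumFields.QCD.Theses.PauliWegnerSea.SingleLinkLogFlatness := by
  refine ⟨9 * (48 * Real.log 2), by positivity, ?_⟩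
  intro L _ U m₀ e g₀
  have hFc := continuous_det_wilsonDirac_update U m₀ e
  obtain ⟨B, hB⟩ : ∃ B : ℝ, ∀ g : Matrix.specialUnitaryGroup (Fin 3) ℂ,
      ‖(wilsonDirac (fundamentalRep (Fin 3)) (Function.update U e g) m₀ 1).det‖ ≤ B := by
    obtain ⟨B, hB⟩ := isCompact_univ.exists_bound_of_continuousOn hFc.continuousOn
    exact ⟨B, fun g => hB g (Set.mem_univ g)⟩
  have key := norm_mul_exp_neg_le_exp_integral_log
    (haarProbability (Matrix.specialUnitaryGroup (Fin 3) ℂ))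
    [fun θ : ℝ => (⟨_, P12_mem θ⟩ : Matrix.specialUnitaryGroup (Fin 3) ℂ), fun θ => ⟨_, R12_mem θ⟩,
      fun θ => ⟨_, P12_mem θ⟩, fun θ => ⟨_, P01_mem θ⟩, fun θ => ⟨_, R01_mem θ⟩,
      fun θ => ⟨_, P01_mem θ⟩, fun θ => ⟨_, P12_mem θ⟩, fun θ => ⟨_, R12_mem θ⟩,
      fun θ => ⟨_, P12_mem θ⟩]
    (by
      intro c hc
      simp only [List.mem_cons, List.not_mem_nil, or_false] at hc
      rcases hc with rfl | rfl | rfl | rfl | rfl | rfl | rfl | rfl | rfl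
      · exact continuous_cP12
      · exact continuous_cR12
      · exact continuous_cP12
      · exact continuous_cP01
      · exact continuous_cR01
      · exact continuous_cP01
      · exact continuous_cP12
      · exact continuous_cR12
      · exact continuous_cP12)
    (F := fun g => (wilsonDirac (fundamentalRep (Fin 3)) (Function.update U e g) m₀ 1).det)
    hFc.measurable hB (n := 48)
    (by
      intro c hc g h
      simp only [List.mem_cons, List.not_mem_nil, or_false] at hc
      rcases hc with rfl | rfl | rfl | rfl | rfl | rfl | rfl | rfl | rfl
      · exact hq_cP12 U m₀ e g h
      · exact hq_cR12 U m₀ e g h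
      · exact hq_cP12 U m₀ e g h
      · exact hq_cP01 U m₀ e g h
      · exact hq_cR01 U m₀ e g h
      · exact hq_cP01 U m₀ e g h
      · exact hq_cP12 U m₀ e g h
      · exact hq_cR12 U m₀ e g h
      · exact hq_cP12 U m₀ e g h)
    g₀ (fun g => reach g g₀)
  have hlen : (([fun θ : ℝ => (⟨_, P12_mem θ⟩ : Matrix.specialUnitaryGroup (Fin 3) ℂ),
      fun θ => ⟨_, R12_mem θ⟩, fun θ => ⟨_, P12_mem θ⟩, fun θ => ⟨_, P01_mem θ⟩, fun θ => ⟨_, R01_mem θ⟩,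
      fun θ => ⟨_, P01_mem θ⟩, fun θ => ⟨_, P12_mem θ⟩, fun θ => ⟨_, R12_mem θ⟩,
      fun θ => ⟨_, P12_mem θ⟩].length : ℕ) : ℝ) = 9 := by
    simp
  rw [hlen] at key
  exact key

end Summit.QuantumFields.QCD.Theorems

end
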